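/-
Copyright (c) 2026 the pub-hodgecm-mathlib formalisation cell (harness21).  Prover seat hodgecm-mathlib-LH4-p12 (g7), req620 Track A «(D-RAM) FOUR-FRAME», line LH4
((d)-lev PART 5 §0, dealer LH4-plan (g13) WORD #83: the one ℚ-identity that converts the right-hand bracket of F0P3a-p01 (g36)'s two-token box-sum ★ p860066
`LevLabelledBoxSum ℓ₁ ℓ₂` into the amplitude letter `ampl q (k − kl d) (B − bl d)` of the level laws, under the dictionary `kl = x(ℓ₁, ℓ₂, d)`, `bl + y(ℓ₁, d) = kl`).  2026-09-04.
-/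
import Literature.NumberTheory.Automorphic.UnitaryThreeFourFrameDefs   -- ★ `ampl`
import HarnessLib

/-!
# Crux `H413`, line LH4 «(D-RAM) FOUR-FRAME» — (d)-lev PART 5 §0: THE BOX BRACKET IS THE SHIFTED AMPLITUDE

★ p860066 `LevLabelledBoxSum ℓ₁ ℓ₂` concludes `(q − 1)·Σ v = SIGN·(q^{k−x} − q^{k−max(x, B′+y)})` with `x = max ℓ₁ ((ℓ₂+1)∕2 − d∕2 + (ℓ₁+1−d%2)∕2)`, `y = 2·((ℓ₁+1−d%2)∕2)`,
`B′ = (nᵢ + 2(d%2) + 2 − 3d)∕2` (ℕ).  The labelled signed κ-Stage B of the level laws wants `SIGN·ampl(q, k − kl d, B − bl d)∕4` with `2B = nᵢ − d + 2 − 2·shiftR d t`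
(`shiftR d t = d − d%2`), `ampl q k B = 4·max 0 (q^k − q^{k−B})∕(q−1)`.  `box_bracket_div_eq_ampl_div`: the two agree when `kl = x` and `bl + y = kl` (the schedules' dictionary),
`kl ≤ k` and `B′ + y ≤ k` — the alive window `[k − B′ − y, k − kl − 1]` ∕ the dead case `B ≤ bl`, exactly as in ★ p860129's sq arithmetic (where `y = 0`, `kl = bl = cs`).

HONEST LABEL: helper lane (`--supports stmt-HodgeConjecture-24833`), count-neutral ℚ-arithmetic; pays no tier-0 row; HC_CM is proved only modulo the 7 printed citations
(2 remaining named inputs: hLiu418 = stmt-HodgeConjecture-24832, h413 = stmt-HodgeConjecture-24833) until rung 0 closes.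

## References (NEVER `[KR2]`)
* [Rogawski1990] J. D. Rogawski, *Automorphic Representations of Unitary Groups in Three Variables*, Ann. of Math. Stud. 123 (1990), §4.9 Prop. 4.9.1 (a) p. 55 (the amplitude of the
  κ-orbital census).
* [Kottwitz1986BaseChangeUnits] R. E. Kottwitz, *Base change for unit elements of Hecke algebras*, Compositio Math. 60 (1986), §1 pp. 240–241.
-/

set_option autoImplicit false

namespace Summit.HodgeConjecture.HodgeConjecture.Cruxes.H413.F0P3cDyRamLevBoxBracketAmpl

open Literature.NumberTheory.Automorphic.UnitaryThreeFourFrame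

/-- **THE BOX BRACKET OVER `q − 1` IS THE SHIFTED AMPLITUDE OVER `4`.**  With `x := max ℓ₁ ((ℓ₂+1)∕2 − d∕2 + (ℓ₁+1−d%2)∕2)`, `y := 2·((ℓ₁+1−d%2)∕2)`,
`B′ := (nᵢ + 2(d%2) + 2 − 3d)∕2`, the dictionary `kl = x`, `bl + y = kl`, the bookkeeping `2B = nᵢ − d + 2 − 2(d − d%2)`, `nᵢ ≡ d (mod 2)`, `kl ≤ k`, `B′ + y ≤ k`, and `1 < q`:
`(q^{k−x} − q^{k−max(x, B′+y)}) ∕ (q − 1) = ampl q (k − kl) (B − bl) ∕ 4`. [cite: Rogawski1990, §4.9 Prop. 4.9.1 (a) p. 55] [cite: Kottwitz1986BaseChangeUnits, §1 pp. 240–241] -/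
theorem box_bracket_div_eq_ampl_div (q : ℕ) (hq : 1 < q) {d k nᵢ ℓ₁ ℓ₂ kl bl : ℕ} {B : ℤ}
    (hkl : kl = max ℓ₁ ((ℓ₂ + 1) / 2 - d / 2 + (ℓ₁ + 1 - d % 2) / 2)) (hbl : bl + 2 * ((ℓ₁ + 1 - d % 2) / 2) = kl)
    (hB : 2 * B = (nᵢ : ℤ) - d + 2 - 2 * ((d - d % 2 : ℕ) : ℤ)) (hpar : nᵢ % 2 = d % 2) (hklk : kl ≤ k)
    (hBk : (nᵢ + 2 * (d % 2) + 2 - 3 * d) / 2 + 2 * ((ℓ₁ + 1 - d % 2) / 2) ≤ k) :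
    ((q : ℚ) ^ (k - max ℓ₁ ((ℓ₂ + 1) / 2 - d / 2 + (ℓ₁ + 1 - d % 2) / 2)) -
        (q : ℚ) ^ (k - max (max ℓ₁ ((ℓ₂ + 1) / 2 - d / 2 + (ℓ₁ + 1 - d % 2) / 2))
          ((nᵢ + 2 * (d % 2) + 2 - 3 * d) / 2 + 2 * ((ℓ₁ + 1 - d % 2) / 2)))) / ((q : ℚ) - 1) =
      ampl q (k - kl) (B - (bl : ℤ)) / 4 := by
  have hq1 : (1 : ℚ) < q := by exact_mod_cast hq
  have hq1' : (q : ℚ) - 1 ≠ 0 := by linarith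
  rw [← hkl]
  set y : ℕ := 2 * ((ℓ₁ + 1 - d % 2) / 2) with hy_def
  set Bn : ℕ := (nᵢ + 2 * (d % 2) + 2 - 3 * d) / 2 with hBn_def
  have hdd : d % 2 ≤ d := Nat.mod_le d 2
  -- the amplitude's `max` in closed form
  have hnum : max 0 ((q : ℚ) ^ ((k - kl : ℕ) : ℤ) - (q : ℚ) ^ (((k - kl : ℕ) : ℤ) - (B - (bl : ℤ)))) =
      (q : ℚ) ^ (k - kl) - (q : ℚ) ^ (k - max kl (Bn + y)) := by
    rw [zpow_natCast]
    by_cases halive : 3 * d ≤ nᵢ + 2 * (d % 2) + 2 ∧ bl + 1 ≤ Bn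
    · -- alive: `B = B′ ≥ bl + 1`, the window sits below its top `kl` layers
      obtain ⟨hnn, hblB⟩ := halive
      have hBB : B = (Bn : ℤ) := by omega
      have hmax : max kl (Bn + y) = Bn + y := max_eq_right (by omega)
      have hexp : ((k - kl : ℕ) : ℤ) - (B - (bl : ℤ)) = (((k - (Bn + y) : ℕ)) : ℤ) := by omega
      rw [hexp, zpow_natCast, hmax]
      exact max_eq_right (sub_nonneg.2 (pow_le_pow_right₀ hq1.le (by omega)))
    · -- dead: `B ≤ bl` — both sides vanish
      have hmax : max kl (Bn + y) = kl := max_eq_left (by omega)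
      have hBle : ((k - kl : ℕ) : ℤ) ≤ ((k - kl : ℕ) : ℤ) - (B - (bl : ℤ)) := by omega
      rw [hmax, sub_self]
      exact max_eq_left (sub_nonpos.2 (by rw [← zpow_natCast]; exact zpow_le_zpow_right₀ hq1.le hBle))
  unfold ampl
  rw [hnum]
  field_simp

end Summit.HodgeConjecture.HodgeConjecture.Cruxes.H413.F0P3cDyRamLevBoxBracketAmpl
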